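import Summits.Ventures.WeilGRH.TwistedSechSeriesEntries
import Summits.RiemannHypothesis.RiemannHypothesis.Theorems.WeilFormatCEntryArchIntegrals
import Literature.Analysis.ValidatedNumerics.IntervalLogArctan
import Literature.NumberTheory.LFunctions.YoshidaWindowGramRecords
import HarnessLib

/-!
# GRH arm (rh-explicit, venture WeilGRH): the `sech` block VALUES as interval boxes — the (E) brick for the
  parity-1 kernel of the χ instance lane

Cell `rh-explicit`, WEIL TRACK — GRH ARM (engine seat weil-grh-2 gen8).  The typed parity-1 data doors
(`weilPositivityOnChar_of_twistedOdd_formatC_dataFull`, `…_dataP`) consume kernel certificates about matrices built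
from `twistedGramCoeffOdd χ a = twistedGramCoeff χ a + π δ − sechIncrCoeff a` (`TwistedGramOddReal.lean`).  The
parity-0 part has its (E) brick (`TwistedGramEntryBox.lean`, gen7); this file supplies the `sech` part.  By
weil-grh-1's `TwistedSechSeriesEntries.lean` every entry of `sechIncrCoeff a` is an alternating finite sum of the
ELEMENTARY integrals `∫_{(0,2a]} e^{−(k+½)t}·{sin ω_n t, 2 − 2(1−t/2a)cos ω_n t} dt` plus an explicit `O(K⁻²)`
remainder (and the closed-form tail `2π − 4 arctan e^{a}` on the diagonal); weil-2's
`WeilFormatCEntryArchIntegrals.lean` has these integrals in CLOSED FORM because `ω_n · 2a = 2πn`.  Hence: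

* `SechEncl.sinClosed_eq` — the elementary sine integral at `ω = πn/a`, `T = 2a` as a rational function of
  `l_k = k + ½`, `ω_n` and `E_k = e^{−2a l_k}` (the diagonal ones: part II, `TwistedSechTableDiag.lean`);
* `SechEncl.abs_sechSin_sub_sum_le` — per MODE `n`: `|I_n − Σ_{k<K} (−1)^k ω_n(1 − E_k)/(l_k² + ω_n²)| ≤ ω_n/(K+½)²`,
  `I_n = ∫_{(0,2a]} σ(t) sin(ω_n t) dt` (`σ(t) = 1/(2cosh(t/2))`);
* the interval layer (weil-2's `NumericsMP.MI` at scale `S`): `SechEncl.expSeq` (`E_k` by products), `omegaBox`,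
  `sinTerm`, `sinSum`, `sinBox`, `sinSigned`, `offBox` with the soundness theorems `mem_sinBox` (`I_n ∈ sinBox`) and
  ★ `mem_offBox` (`sechIncrCoeff a n m ∈ offBox`, `n ≠ m`, signed modes via `I_{−n} = −I_n`); the diagonal entry
  (`diagBox`, `mem_diagBox`) is part II, `TwistedSechTableDiag.lean`.

Sizing (this seat's twin, 2026-08-23): the cells that turn the arm's uniform rungs into COMPLETE rungs — `t = 2/5` for
EVERY primitive Dirichlet character needs exactly the cell `(−3/·) @ 2/5` (door H, blocks `4 × 8 ∣ 4 × 8`), `t = (log 3)/2`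
needs `(−3/·)` and `(−4/·)` (`4 × 16`) — so the tables here are needed for `n ≤ 20` modes and `K ≈ 10³` terms.
Everything is PROVED; computable `def`s with docstrings; no named facts; RH/GRH-free; standard axioms.
References: H. Yoshida (1992) §5 [Yoshida1992HermitianForms]; R. E. Moore (1966) Ch. 3 [Moore1966].
-/

set_option autoImplicit false

open Real MeasureTheory Set Finset
open scoped BigOperators

namespace Summit.Ventures.WeilGRH

open Literature.Analysis.ValidatedNumerics.NumericsMP
open Summit.RiemannHypothesis.RiemannHypothesis.Theorems.WeilFormatC

namespace SechEncl

variable {a : ℝ}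

/-! ## The elementary integrals in closed form (`ω_n · 2a = 2πn`) -/

/-- `∫_{(0,2a]} e^{−lt} sin(πn t/a) dt = ω(1 − e^{−2al})/(l² + ω²)`, `ω = πn/a`. -/
theorem sinClosed_eq (ha : 0 < a) (n : ℤ) {l : ℝ} (hl : 0 < l) :
    ∫ t in Ioc 0 (2 * a), Real.exp (-(l * t)) * Real.sin (π * n / a * t)
      = (π * n / a) * (1 - Real.exp (-(l * (2 * a)))) / (l ^ 2 + (π * n / a) ^ 2) := by
  rw [← intervalIntegral.integral_of_le (by positivity : (0 : ℝ) ≤ 2 * a)]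
  have hωT : π * n / a * (2 * a) = 2 * π * n := by field_simp
  exact integral_exp_neg_mul_sin hωT (by positivity)

/-! ## Per-mode values with explicit remainders -/

/-- **The sine value of mode `n` with remainder**: `|I_n − Σ_{k<K} (−1)^k ω(1 − E_k)/(l_k² + ω²)| ≤ ω/(K+½)²`
for `ω = πn/a ≥ 0` (`n : ℕ`), `E_k = e^{−2a(k+½)}`. -/
theorem abs_sechSin_sub_sum_le (ha : 0 < a) (n : ℕ) (K : ℕ) :
    |(∫ t in Ioc 0 (2 * a), 1 / (2 * Real.cosh (t / 2)) * Real.sin (π * n / a * t))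
        - ∑ k ∈ Finset.range K, (-1 : ℝ) ^ k *
          ((π * n / a) * (1 - Real.exp (-((k + 1 / 2) * (2 * a)))) / ((k + 1 / 2) ^ 2 + (π * n / a) ^ 2))|
      ≤ (π * n / a) / (K + 1 / 2) ^ 2 := by
  have hω : 0 ≤ π * n / a := by positivity
  have hsum : ∑ k ∈ Finset.range K, (-1 : ℝ) ^ k *
      ((π * n / a) * (1 - Real.exp (-((k + 1 / 2) * (2 * a)))) / ((k + 1 / 2) ^ 2 + (π * n / a) ^ 2))
      = ∑ k ∈ Finset.range K, (-1 : ℝ) ^ k *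
          ∫ t in Ioc 0 (2 * a), Real.exp (-((k + 1 / 2) * t)) * Real.sin (π * n / a * t) := by
    refine Finset.sum_congr rfl fun k _ ↦ ?_
    have hl : (0 : ℝ) < k + 1 / 2 := by positivity
    have h := sinClosed_eq ha (n : ℤ) hl
    push_cast at h ⊢
    rw [h]
  rw [hsum]
  refine abs_integral_sech_mul_sub_sum_le (F := fun t ↦ Real.sin (π * n / a * t)) (by fun_prop) hω
    (fun t ht ↦ ?_) K
  have h := abs_offDiag_kernel_le (π * n / a) 0 ht.1.le
  simpa [abs_of_nonneg hω] using h

/-! ## Interval boxes (NumericsMP `MI` at scale `S`) -/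

section Boxes

variable {S : ℕ}

/-- `1 ∈ ofInt S 1`. [cite: Moore1966, Ch. 3 (interval arithmetic: inclusion property)] -/
theorem mem_one (S : ℕ) : MI.mem S (1 : ℝ) (MI.ofInt S 1) := by
  simpa using MI.mem_ofInt S 1

/-- `E_k = e^{−a(2k+1)}` by products: `E_0 ∈ E0 ∋ e^{−a}`, `E_{k+1} = E_k · R`, `R ∋ e^{−2a}`.
[cite: Moore1966, Ch. 3 (interval arithmetic: inclusion property)] -/
def expSeq (S : ℕ) (E0 R : MI) : ℕ → MI
  | 0 => E0
  | k + 1 => (expSeq S E0 R k).mul S R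

/-- `expSeq` encloses `e^{−(k+½)·2a}`. [cite: Moore1966, Ch. 3 (interval arithmetic: inclusion property)] -/
theorem mem_expSeq (hS : 0 < S) {E0 R : MI} (hE0 : MI.mem S (Real.exp (-a)) E0)
    (hR : MI.mem S (Real.exp (-(2 * a))) R) :
    ∀ k : ℕ, MI.mem S (Real.exp (-((((k : ℕ) : ℝ) + 1 / 2) * (2 * a)))) (expSeq S E0 R k)
  | 0 => by
      have e : Real.exp (-((((0 : ℕ) : ℝ) + 1 / 2) * (2 * a))) = Real.exp (-a) := by
        congr 1; push_cast; ring
      rw [expSeq, e]; exact hE0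
  | k + 1 => by
      have e : Real.exp (-((((k + 1 : ℕ) : ℝ) + 1 / 2) * (2 * a)))
          = Real.exp (-((((k : ℕ) : ℝ) + 1 / 2) * (2 * a))) * Real.exp (-(2 * a)) := by
        rw [← Real.exp_add]; congr 1; push_cast; ring
      rw [expSeq, e]
      exact MI.mem_mul hS (mem_expSeq hS hE0 hR k) hR

/-- `l_k = (2k+1)/2`. [cite: Moore1966, Ch. 3 (interval arithmetic: inclusion property)] -/
def lBox (S : ℕ) (k : ℕ) : MI := MI.ofFrac S (2 * k + 1) 2

/-- `lBox` encloses `k + ½`. [cite: Moore1966, Ch. 3 (interval arithmetic: inclusion property)] -/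
theorem mem_lBox (S : ℕ) (k : ℕ) : MI.mem S (((k : ℕ) : ℝ) + 1 / 2) (lBox S k) := by
  have h := MI.mem_ofFrac S (2 * (k : ℤ) + 1) (q := 2) (by norm_num)
  have e : (((2 * (k : ℤ) + 1 : ℤ) : ℝ)) / ((2 : ℕ) : ℝ) = (k : ℝ) + 1 / 2 := by push_cast; ring
  rw [e] at h
  exact h

/-- The frequency box `ω_n = πn/a` from boxes of `π` and `a`. [cite: Moore1966, Ch. 3 (interval arithmetic: inclusion property)] -/
def omegaBox (S : ℕ) (P A : MI) (n : ℕ) : Option MI := MI.divPos S (P.mulInt n) A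

/-- `omegaBox` encloses `πn/a`. [cite: Moore1966, Ch. 3 (interval arithmetic: inclusion property)] -/
theorem mem_omegaBox (hS : 0 < S) {P A Ω : MI} (hP : MI.mem S Real.pi P) (hA : MI.mem S a A) {n : ℕ}
    (h : omegaBox S P A n = some Ω) : MI.mem S (π * n / a) Ω := by
  have h1 : MI.mem S (π * (n : ℤ)) (P.mulInt n) := MI.mem_mulInt hP (n : ℤ)
  push_cast at h1
  exact MI.mem_divPos hS h h1 hA

/-- One sine term `ω(1 − E_k)/(l_k² + ω²)`. [cite: Moore1966, Ch. 3 (interval arithmetic: inclusion property)] -/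
def sinTerm (S : ℕ) (Ω Ek : MI) (k : ℕ) : Option MI :=
  MI.divPos S (Ω.mul S ((MI.ofInt S 1).sub Ek)) (((lBox S k).sqr S).add (Ω.sqr S))

/-- `sinTerm` encloses `ω(1 − E)/(l_k² + ω²)`. [cite: Moore1966, Ch. 3 (interval arithmetic: inclusion property)] -/
theorem mem_sinTerm (hS : 0 < S) {Ω Ek T : MI} {ω E : ℝ} (hΩ : MI.mem S ω Ω) (hE : MI.mem S E Ek) {k : ℕ}
    (h : sinTerm S Ω Ek k = some T) :
    MI.mem S (ω * (1 - E) / ((((k : ℕ) : ℝ) + 1 / 2) ^ 2 + ω ^ 2)) T :=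
  MI.mem_divPos hS h (MI.mem_mul hS hΩ (MI.mem_sub (mem_one S) hE))
    (MI.mem_add (MI.mem_sqr hS (mem_lBox S k)) (MI.mem_sqr hS hΩ))

/-- Alternating partial sum `Σ_{k<K} (−1)^k · sinTerm k`. [cite: Moore1966, Ch. 3 (interval arithmetic: inclusion property)] -/
def sinSum (S : ℕ) (Ω E0 R : MI) : ℕ → Option MI
  | 0 => some (MI.ofInt S 0)
  | K + 1 =>
    match sinSum S Ω E0 R K, sinTerm S Ω (expSeq S E0 R K) K with
    | some acc, some t => some (if K % 2 = 0 then acc.add t else acc.sub t)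
    | _, _ => none

/-- `sinSum K` encloses the alternating partial sum. [cite: Moore1966, Ch. 3 (interval arithmetic: inclusion property)] -/
theorem mem_sinSum (hS : 0 < S) {Ω E0 R : MI} {ω : ℝ} (hΩ : MI.mem S ω Ω) (hE0 : MI.mem S (Real.exp (-a)) E0)
    (hR : MI.mem S (Real.exp (-(2 * a))) R) :
    ∀ (K : ℕ) {Y : MI}, sinSum S Ω E0 R K = some Y →
      MI.mem S (∑ k ∈ Finset.range K, (-1 : ℝ) ^ k *
        (ω * (1 - Real.exp (-((k + 1 / 2) * (2 * a)))) / ((k + 1 / 2) ^ 2 + ω ^ 2))) Y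
  | 0, Y, h => by
      simp only [sinSum, Option.some.injEq] at h
      subst h
      simpa using MI.mem_ofInt S 0
  | K + 1, Y, h => by
      simp only [sinSum] at h
      split at h
      · rename_i acc t hacc ht
        simp only [Option.some.injEq] at h
        subst h
        have ih := mem_sinSum hS hΩ hE0 hR K hacc
        have hterm := mem_sinTerm hS hΩ (mem_expSeq hS hE0 hR K) ht
        rw [Finset.sum_range_succ]
        by_cases hK : K % 2 = 0
        · rw [if_pos hK]
          have hs : (-1 : ℝ) ^ K = 1 := by
            obtain ⟨j, hj⟩ := Nat.even_iff.mpr hK; rw [hj, ← two_mul, pow_mul]; norm_num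
          rw [hs, one_mul]
          exact MI.mem_add ih hterm
        · rw [if_neg hK]
          have hs : (-1 : ℝ) ^ K = -1 := by
            have hK' : K % 2 = 1 := Nat.mod_two_ne_zero.mp hK
            obtain ⟨j, hj⟩ := Nat.odd_iff.mpr hK'; rw [hj, pow_succ, pow_mul]; norm_num
          rw [hs, neg_one_mul, ← sub_eq_add_neg]
          exact MI.mem_sub ih hterm
      · simp at h

/-- **The sine value box**: the partial sum widened by `⌈4·max(Ω.hi,0)/(2K+1)²⌉ ≥ S·ω/(K+½)²`.
[cite: Moore1966, Ch. 3 (interval arithmetic: inclusion property)] -/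
def sinBox (S : ℕ) (Ω E0 R : MI) (K : ℕ) : Option MI :=
  (sinSum S Ω E0 R K).map fun Y ↦ Y.widen (cdiv (4 * max Ω.hi 0) ((2 * (K : ℤ) + 1) ^ 2))

/-- ★ `sinBox` encloses `I_n = ∫_{(0,2a]} σ(t) sin(πn t/a) dt` (`Ω ∋ πn/a`).
[cite: Moore1966, Ch. 3 (interval arithmetic: inclusion property)] -/
theorem mem_sinBox (hS : 0 < S) (ha : 0 < a) {P A Ω E0 R : MI} (hP : MI.mem S Real.pi P) (hA : MI.mem S a A)
    {n : ℕ} (hΩ : omegaBox S P A n = some Ω) (hE0 : MI.mem S (Real.exp (-a)) E0)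
    (hR : MI.mem S (Real.exp (-(2 * a))) R) {K : ℕ} {Y : MI} (h : sinBox S Ω E0 R K = some Y) :
    MI.mem S (∫ t in Ioc 0 (2 * a), 1 / (2 * Real.cosh (t / 2)) * Real.sin (π * n / a * t)) Y := by
  have hω := mem_omegaBox hS hP hA hΩ
  unfold sinBox at h
  cases hsum : sinSum S Ω E0 R K with
  | none => simp [hsum] at h
  | some Z =>
    simp only [hsum, Option.map_some, Option.some.injEq] at h
    subst h
    have hZ := mem_sinSum hS hω hE0 hR K hsum
    refine MI.mem_widen hZ ?_
    have hrem := abs_sechSin_sub_sum_le ha n K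
    -- `ω·S ≤ Ω.hi ≤ max Ω.hi 0`
    have hωS : π * n / a * S ≤ ((max Ω.hi 0 : ℤ) : ℝ) := by
      have := hω.2; push_cast; exact this.trans (by exact_mod_cast le_max_left _ _)
    have hK : (0 : ℝ) < (K + 1 / 2) ^ 2 := by positivity
    have hS0 : (0 : ℝ) ≤ S := by positivity
    have hden : (0 : ℤ) < (2 * (K : ℤ) + 1) ^ 2 := by positivity
    have hcd := div_le_cdiv (a := 4 * max Ω.hi 0) hden
    have hmax0 : (0 : ℝ) ≤ ((max Ω.hi 0 : ℤ) : ℝ) := by exact_mod_cast le_max_right _ _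
    calc |(∫ t in Ioc 0 (2 * a), 1 / (2 * Real.cosh (t / 2)) * Real.sin (π * n / a * t)) -
            ∑ k ∈ Finset.range K, (-1 : ℝ) ^ k *
              (π * n / a * (1 - Real.exp (-((k + 1 / 2) * (2 * a)))) / ((k + 1 / 2) ^ 2 + (π * n / a) ^ 2))| * S
        ≤ (π * n / a) / (K + 1 / 2) ^ 2 * S := mul_le_mul_of_nonneg_right hrem hS0
      _ = (π * n / a * S) / (K + 1 / 2) ^ 2 := by ring
      _ ≤ ((max Ω.hi 0 : ℤ) : ℝ) / (K + 1 / 2) ^ 2 := div_le_div_of_nonneg_right hωS hK.le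
      _ = ((4 * max Ω.hi 0 : ℤ) : ℝ) / (((2 * (K : ℤ) + 1) ^ 2 : ℤ) : ℝ) := by
          push_cast; field_simp; ring
      _ ≤ _ := hcd

/-! ### Signed modes and the off-diagonal entry -/

/-- `I_{−n} = −I_n` and the table lookup: the sine value of a SIGNED mode from a table of the values at `|j|`. -/
def sinSigned (tab : ℕ → MI) (j : ℤ) : MI := if 0 ≤ j then tab j.natAbs else (tab j.natAbs).neg

/-- `sinSigned` encloses `I_j` for every integer `j` when `tab` encloses `I_n` for `n : ℕ`. -/
theorem mem_sinSigned {tab : ℕ → MI}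
    (htab : ∀ n : ℕ, MI.mem S (∫ t in Ioc 0 (2 * a), 1 / (2 * Real.cosh (t / 2)) * Real.sin (π * n / a * t)) (tab n))
    (j : ℤ) : MI.mem S (∫ t in Ioc 0 (2 * a), 1 / (2 * Real.cosh (t / 2)) * Real.sin (π * j / a * t)) (sinSigned tab j) := by
  unfold sinSigned
  split_ifs with hj
  · have e : ((j.natAbs : ℕ) : ℝ) = (j : ℝ) := by
      rw [Nat.cast_natAbs, Int.cast_abs, abs_of_nonneg (by exact_mod_cast hj)]
    have h := htab j.natAbs; rw [e] at h; exact h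
  · have e : ((j.natAbs : ℕ) : ℝ) = -(j : ℝ) := by
      rw [Nat.cast_natAbs, Int.cast_abs, abs_of_neg (by exact_mod_cast (not_le.mp hj))]
    have h := htab j.natAbs
    rw [e] at h
    have hodd : (∫ t in Ioc 0 (2 * a), 1 / (2 * Real.cosh (t / 2)) * Real.sin (π * j / a * t))
        = -(∫ t in Ioc 0 (2 * a), 1 / (2 * Real.cosh (t / 2)) * Real.sin (π * -(j : ℝ) / a * t)) := by
      rw [← integral_neg]
      refine setIntegral_congr_fun measurableSet_Ioc fun t _ ↦ ?_
      rw [show π * -(j : ℝ) / a * t = -(π * j / a * t) by ring, Real.sin_neg]; ring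
    rw [hodd]
    exact MI.mem_neg h

/-- The parity sign `(−1)^{j}` of an integer as an integer. -/
def negOnePow (j : ℤ) : ℤ := if j % 2 = 0 then 1 else -1

/-- `(−1 : ℝ)^j = negOnePow j` (integer power). -/
theorem neg_one_zpow_eq_negOnePow (j : ℤ) : (-1 : ℝ) ^ j = ((negOnePow j : ℤ) : ℝ) := by
  unfold negOnePow
  split_ifs with h
  · push_cast; exact (Int.even_iff.mpr h).neg_one_zpow
  · push_cast; exact (Int.odd_iff.mpr (Int.emod_two_ne_zero.mp h)).neg_one_zpow

/-- The off-diagonal `sech` entry box: `−(−1)^{n+m} sgn(n−m)/(π|n−m|) · (I_m − I_n)`.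
[cite: Moore1966, Ch. 3 (interval arithmetic: inclusion property)] -/
def offBox (S : ℕ) (P : MI) (tab : ℕ → MI) (n m : ℤ) : Option MI :=
  MI.divPos S (((sinSigned tab m).sub (sinSigned tab n)).mulInt (-(negOnePow (n + m) * (n - m).sign)))
    (P.mulInt (n - m).natAbs)

/-- ★ `offBox` encloses `sechIncrCoeff a n m` for `n ≠ m`. [cite: Moore1966, Ch. 3 (interval arithmetic: inclusion property)] -/
theorem mem_offBox (hS : 0 < S) {P : MI} (hP : MI.mem S Real.pi P) {tab : ℕ → MI}
    (htab : ∀ n : ℕ, MI.mem S (∫ t in Ioc 0 (2 * a), 1 / (2 * Real.cosh (t / 2)) * Real.sin (π * n / a * t)) (tab n))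
    {n m : ℤ} (hnm : n ≠ m) {Y : MI} (h : offBox S P tab n m = some Y) :
    MI.mem S (sechIncrCoeff a n m) Y := by
  set Im := ∫ t in Ioc 0 (2 * a), 1 / (2 * Real.cosh (t / 2)) * Real.sin (π * m / a * t) with hIm
  set In := ∫ t in Ioc 0 (2 * a), 1 / (2 * Real.cosh (t / 2)) * Real.sin (π * n / a * t) with hIn
  have hnum : MI.mem S ((Im - In) * ((-(negOnePow (n + m) * (n - m).sign) : ℤ) : ℝ))
      (((sinSigned tab m).sub (sinSigned tab n)).mulInt (-(negOnePow (n + m) * (n - m).sign))) :=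
    MI.mem_mulInt (MI.mem_sub (mem_sinSigned htab m) (mem_sinSigned htab n)) _
  have hden : MI.mem S (π * |(n : ℝ) - m|) (P.mulInt (n - m).natAbs) := by
    have := MI.mem_mulInt hP ((n - m).natAbs : ℤ); push_cast at this ⊢; exact this
  have hq := MI.mem_divPos hS h hnum hden
  -- identify the value: `n − m = sgn(n−m)·|n−m|`, `sgn² = 1`, `(−1)^{n+m} = negOnePow (n+m)`
  have hsgN : (((n - m).sign : ℤ) : ℝ) * |(n : ℝ) - m| = (n : ℝ) - m := by
    have h0 := Int.sign_mul_natAbs (n - m)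
    have h1 : (((n - m).sign * ((n - m).natAbs : ℤ) : ℤ) : ℝ) = (((n - m : ℤ)) : ℝ) := by rw [h0]
    push_cast at h1
    exact h1
  have hsg2 : (((n - m).sign : ℤ) : ℝ) * (((n - m).sign : ℤ) : ℝ) = 1 := by
    rcases lt_or_gt_of_ne (sub_ne_zero.mpr hnm) with hlt | hgt
    · rw [Int.sign_eq_neg_one_of_neg hlt]; norm_num
    · rw [Int.sign_eq_one_of_pos hgt]; norm_num
  have hN0 : |(n : ℝ) - m| ≠ 0 := abs_ne_zero.mpr (sub_ne_zero.mpr (by exact_mod_cast hnm))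
  have hval : sechIncrCoeff a n m
      = (Im - In) * ((-(negOnePow (n + m) * (n - m).sign) : ℤ) : ℝ) / (π * |(n : ℝ) - m|) := by
    unfold sechIncrCoeff
    rw [if_neg hnm, neg_one_zpow_eq_negOnePow, ← hIm, ← hIn]
    have hginv : ((((n - m).sign : ℤ) : ℝ))⁻¹ = (((n - m).sign : ℤ) : ℝ) := inv_eq_of_mul_eq_one_right hsg2
    push_cast
    set A : ℝ := |(n : ℝ) - (m : ℝ)| with hAdef
    rw [← hsgN]
    have key : (π * ((((n - m).sign : ℤ) : ℝ) * A))⁻¹ = (((n - m).sign : ℤ) : ℝ) * (π * A)⁻¹ := by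
      rw [mul_inv, mul_inv, mul_inv, hginv]; ring
    rw [div_eq_mul_inv, div_eq_mul_inv, key]
    ring
  rw [hval]
  exact hq

end Boxes

end SechEncl

end Summit.Ventures.WeilGRH
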